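import Summits.QuantumFields.YangMills.Theses.ParabolicTrajectory
import Literature.MathematicalPhysics.QuantumFieldTheory.BalabanBanachStep

/-!
# Route `ParabolicTrajectory`, crux `LatticeGapOnTrajectory` (stmt-QuantumFields-10523):
# vocabulary of the line `trajectory-gap-scaling`

Route-posited objects (D-0016 `<Route><Crux>…Defs` file) shared by the registered stubs of the skeleton
`Cruxes/LatticeGapOnTrajectory/Lines/trajectory-gap-scaling.lean` (planner
`planner-cruxplan-stmt-QuantumFields-10523-trajectory-gap-scali-0`; lead `prover-line-stmt-QuantumFields-10523-c1-0`)
and by the crux file that composes them. The declarations are VERBATIM those of the registered skeleton (same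
namespace, so the registered stub signatures are unchanged); NOTHING in this file is asserted: every `def … : Prop` is
a statement some stub proves (`TubeVisited`, `GapScaling`, `ScaleIdentification`, `FineScaleTransfer`,
`SpectralTransfer`, `ArcCertificate`) or a predicate those statements are built from; the one `theorem` is the
registered glue `mem_chart_iff` (chart membership unfolded).

* §1 Vocabulary over the hypothesis structure `BalabanBanachStep` (Literature): `chart`, `tube`, `IsCurveData`
  (the conclusion shape of the proved route item `ParabolicCentreCurve` with two explicit margins), `IsTimeCompact`,
  `ClustersOn` (rate-free clustering certificate of the effective theories on a region), `BlockClustering`,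
  `FineClustering`, `UVSmall` (volume-uniform asymptotic-freedom smallness of the dimensionless plaquette correlator).
* §2 The six stub statements of the line, as plain `Prop`s.
* §3 Glue: `mem_chart_iff`.

References: Balaban1988Convergent (0.1), Thm. 1; Dimock2013 §2.1; OsterwalderSeiler1978 §2; the line card
`Cruxes/LatticeGapOnTrajectory/Lines/trajectory-gap-scaling.md` and triage notes TRIAGE-r1-1/2/3.
-/

open scoped SchwartzMap
open MeasureTheory Filter Topology
open Literature.MathematicalPhysics.QuantumFieldTheory Literature.MathematicalPhysics.QuantumLattice
open Summit.QuantumFields.YangMills.Theses.ParabolicTrajectory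

noncomputable section

namespace Summit.QuantumFields.YangMills.Cruxes.LatticeGapOnTrajectory.TrajectoryGapScaling

/-! ## §1 Vocabulary over `BalabanBanachStep` (transparent abbreviations) -/

section Vocabulary

variable {G : Type} [Group G] [TopologicalSpace G] [IsTopologicalGroup G] [CompactSpace G]
  [MeasurableSpace G] [BorelSpace G] {r : LatticeRep G} {M : ℕ}

/-- The chart `[0, δ] × B̄_R` on which (4a) covariance and (4c) continuity of `expect` are stated. -/
def chart (S : BalabanBanachStep G r M) : Set (ℝ × S.E) :=
  Set.Icc 0 S.δ ×ˢ Metric.closedBall (0 : S.E) S.R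

/-- The tube of fibre-radius `ε` around the graph of `h` over the coupling window `[γ, γ']`
(a thickened fundamental arc of the renormalised trajectory when `γ' ≥ γ + 2bγ³ ≥ φ γ (h γ)`). -/
def tube (S : BalabanBanachStep G r M) (h : ℝ → S.E) (γ γ' ε : ℝ) : Set (ℝ × S.E) :=
  {p | p.1 ∈ Set.Icc γ γ' ∧ ‖p.2 - h p.1‖ ≤ ε}

/-- **Centre-unstable-curve data** for `S` on `[0, δ']`: the conclusion of the route item
`ParabolicCentreCurve` at `(S.E, S.φ, S.Ψ, S.A, S.b, S.θ, S.C, S.δ)` (continuity, `h 0 = 0`, the bound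
`‖h g‖ ≤ C' g²`, invariance, exponential ATTRACTION of in-chart orbit segments), restricted to a radius
`δ'` small enough for two explicit margins used by the dynamics stubs: DRIFT `4Cδ' ≤ b` (so
`g + (b/2)g³ ≤ φ g y ≤ g + (3b/2)g³` for `0 ≤ g ≤ δ'`, `‖y‖ ≤ δ'`) and FIBRE INVARIANCE
`2Cδ' ≤ 1 − θ` (so `Ψ g` maps the `δ'`-ball into itself for `|g| ≤ δ'`), and `‖h g‖ ≤ δ'/2`.
Uniqueness of the curve is not recorded (not used). -/
def IsCurveData (S : BalabanBanachStep G r M) (δ' K θ₁ C' : ℝ) (h : ℝ → S.E) : Prop :=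
  0 < δ' ∧ δ' ≤ S.δ ∧ 0 ≤ K ∧ 0 ≤ θ₁ ∧ θ₁ < 1 ∧ 0 ≤ C' ∧
  4 * S.C * δ' ≤ S.b ∧ 2 * S.C * δ' ≤ 1 - S.θ ∧
  ContinuousOn h (Set.Icc 0 δ') ∧ h 0 = 0 ∧
  (∀ g ∈ Set.Icc 0 δ', ‖h g‖ ≤ C' * g ^ 2) ∧ (∀ g ∈ Set.Icc 0 δ', ‖h g‖ ≤ δ' / 2) ∧
  (∀ g ∈ Set.Icc 0 δ', S.φ g (h g) ≤ δ' → S.Ψ g (h g) = h (S.φ g (h g))) ∧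
  (∀ (p : ℝ × S.E) (k : ℕ),
    (∀ i ≤ k, (S.F^[i] p).1 ∈ Set.Icc 0 δ' ∧ ‖(S.F^[i] p).2‖ ≤ δ') →
      ‖(S.F^[k] p).2 - h (S.F^[k] p).1‖ ≤ K * θ₁ ^ k * ‖p.2 - h p.1‖)

/-- **Time-compact test functions**: support in the slab `|x⁰| ≤ 1/3` (triage r1-2 (1), r1-3 (1):
with arbitrary Schwartz tails in time a fixed exponential clustering rate is false by transfer-matrix
positivity; after an integer time shift `t ≥ 1` the two slabs are `≥ 1/3` apart, so the two-point
tuples below are off-diagonal). -/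
def IsTimeCompact (f : 𝓢(EuclideanSpace ℝ (Fin 4), ℝ)) : Prop :=
  tsupport (f : EuclideanSpace ℝ (Fin 4) → ℝ) ⊆ {x | |x 0| ≤ 1 / 3}

/-- **Uniform clustering of the effective theories on `U`** at rate `m` per UNIT-lattice time step:
for every species pair and every pair of time-compact test functions there are `C, T₁`, uniform over
`p ∈ U`, over all tori of `2T+1 ≥ 2T₁+1` sites and all integer separations `1 ≤ t ≤ T`, bounding the
centred two-point function `S.expect p (2T+1) 2 σ ![f, τ_t f']`. Rate-free in `k`: a property of ONE
region of unit-lattice theories (the certificate's target). -/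
def ClustersOn (S : BalabanBanachStep G r M) (U : Set (ℝ × S.E)) (m : ℝ) : Prop :=
  ∀ (σ : Fin 2 → YMSpecies G) (f f' : 𝓢(EuclideanSpace ℝ (Fin 4), ℝ)),
    IsTimeCompact f → IsTimeCompact f' →
    ∃ C : ℝ, ∃ T₁ : ℕ, ∀ p ∈ U, ∀ T : ℕ, T₁ ≤ T → ∀ t : ℕ, 1 ≤ t → t ≤ T →
      |S.expect p (2 * T + 1) 2 σ ![f, timeShiftTest 4 (t : ℝ) f']| ≤ C * Real.exp (-(m * t))

variable (r) in
/-- **Block clustering along a sequence of Wilson theories** `β k` with block scales `M'^(j k)`: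
the UNIT-normalised centred two-point functions of every species pair, smeared with `j k`-fold
`M'`-dilated time-compact test functions at integer block separations `1 ≤ t ≤ T`, on the fine tori
of side `M'^(j k)·(2T+1)` (`T ≥ T₁`), decay like `C e^{−m t}` eventually in `k` — clustering at rate
`m` per BLOCK, i.e. at the physical rate, with `k`-uniform constants. -/
def BlockClustering (β : ℕ → ℝ) (M' : ℕ) (j : ℕ → ℕ) (m : ℝ) : Prop :=
  ∀ (σ : Fin 2 → YMSpecies G) (f f' : 𝓢(EuclideanSpace ℝ (Fin 4), ℝ)),
    IsTimeCompact f → IsTimeCompact f' →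
    ∃ C : ℝ, ∃ T₁ : ℕ, ∀ᶠ k in atTop, ∀ T : ℕ, T₁ ≤ T → ∀ t : ℕ, 1 ≤ t → t ≤ T →
      |wilsonCentredSchwinger r.ρ (β k) ((M' ^ j k * (2 * T + 1) - 1) / 2) (fun _ => 1) 2 σ
          ![(blockDilate M')^[j k] f, (blockDilate M')^[j k] (timeShiftTest 4 (t : ℝ) f')]|
        ≤ C * Real.exp (-(m * t))

variable (r) in
/-- **Fine-scale clustering along a sequence** `β k` with scales `D k`: every pair of fine-local
gauge-invariant observables has a `k`-uniform constant `C` with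
`|⟨A ; τ_n B⟩_{β_k, 2S+1}| ≤ C e^{−Δ₁ n / D_k}` on ALL tori `2S+1` with `S ≥ S₁ D_k` and all `n ≤ S`,
eventually in `k` (the shape of `HasLatticeMassGap` with the rate in units of `D_k`). -/
def FineClustering (β : ℕ → ℝ) (D : ℕ → ℕ) (Δ₁ : ℝ) (S₁ : ℕ) : Prop :=
  ∀ A B : YMSpecies G, ∃ C : ℝ, ∀ᶠ k in atTop, ∀ S : ℕ, S₁ * D k ≤ S → ∀ n : ℕ, n ≤ S →
    |latticeConnectedCorr r.ρ (β k) (2 * S + 1) A.F B.F n| ≤ C * Real.exp (-(Δ₁ / D k * n))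

/-- **Asymptotic-freedom smallness of the dimensionless plaquette correlator, uniformly in the
volume**: whenever a Wilson orbit point `F^[i] (g, yW g)` (in-chart history) is `ρ`-close to the free
fixed point `(0, 0)`, the fine Wilson theory at `β = betaOf g` has
`n⁸ |⟨P ; τ_n P⟩_{2L+1}| ≤ ε'` for all separations `n` in the block decade `[M^i, M^{i+1}]` and ALL
tori `2L+1` with `L ≥ N M^i` (P = `r.curvature`, the Wilson action density). The chart sees only the
tori `M^i(2T+1)` and only smeared fields; this is the fine-scale, all-volume, pointwise form
(Bałaban small-field bound `D⁸ corr(D) ≲ g(D)⁴`). -/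
def UVSmall (S : BalabanBanachStep G r M) : Prop :=
  ∀ ε' : ℝ, 0 < ε' → ∃ ρ : ℝ, 0 < ρ ∧ ∃ N : ℕ, ∀ g ∈ Set.Ioc 0 S.g₀, ∀ i : ℕ,
    (∀ l ≤ i, S.F^[l] (g, S.yW g) ∈ chart S) →
    (S.F^[i] (g, S.yW g)).1 < ρ → ‖(S.F^[i] (g, S.yW g)).2‖ < ρ →
    ∀ L : ℕ, N * M ^ i ≤ L → ∀ n : ℕ, M ^ i ≤ n → n ≤ M * M ^ i →
      (n : ℝ) ^ 8 * |latticeConnectedCorr r.ρ (S.betaOf g) (2 * L + 1) r.curvature.F r.curvature.F n|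
        ≤ ε'

end Vocabulary

/-! ## §2 The six stub statements -/

/-- **Stub 1 statement — the arc certificate (the residual crux `C⁺`, HARDEST).** For every compact
simple `G` and lattice representation `r` there are an ODD chart block factor `M'` and a realisation `S`
of Bałaban's step (route crux `BalabanStepParabolic`, 9684 — its existence is part of the burden here)
(i) whose unit-scale species normalisations stay bounded away from `0`, (ii) which satisfies the
volume-uniform asymptotic-freedom bound `UVSmall S` (for Bałaban's own realisation the coupling
coordinate IS the running coupling and the small-field expansion bounds pointwise plaquette correlators;
stated for THIS `S`, not for every instance, because for an abstract instance only smeared correlators on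
`M'`-adic tori are tied to the coordinates), (iii) with centre-unstable-curve data (route item
`ParabolicCentreCurve`, 9175, after shrinking `δ'`), and (iv) a coupling window `[γ, γ']` one fundamental
domain long (`γ + 2bγ³ ≤ γ' ≤ δ'`), a fibre radius `ε` and a rate `m > 0` such that the effective theories
in the tube cluster uniformly (`ClustersOn`) — the CERTIFICATE. Mechanism intended for (iv): a rate-free
finite-volume mixing certificate (Dobrushin–Shlosman constructive condition / KP after coarse-graining)
for ONE cube of the effective theory at the window edge, OPEN in the `E`-norm, on finitely many balls
covering the compact arc. -/
def ArcCertificate : Prop :=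
  ∀ (G : Type) [Group G] [TopologicalSpace G] [IsTopologicalGroup G] [CompactSpace G]
    [MeasurableSpace G] [BorelSpace G], IsCompactSimpleLieGroup G →
    ∀ r : LatticeRep G, ∃ M' : ℕ, Odd M' ∧ ∃ S : BalabanBanachStep G r M',
      (∀ σ : YMSpecies G, ∃ c₀ : ℝ, 0 < c₀ ∧ ∀ g ∈ Set.Ioc 0 S.g₀, c₀ ≤ |S.c g σ|) ∧ UVSmall S ∧
      ∃ (δ' K θ₁ C' : ℝ) (h : ℝ → S.E), IsCurveData S δ' K θ₁ C' h ∧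
        ∃ γ γ' ε m : ℝ, 0 < γ ∧ γ + 2 * S.b * γ ^ 3 ≤ γ' ∧ γ' ≤ δ' ∧ 0 < ε ∧ 0 < m ∧
          ClustersOn S (tube S h γ γ' ε) m

/-- **Stub 2 statement — every large-`β` Wilson theory flows into the tube (λ-lemma).** Given curve
data and a one-domain window `[γ, γ']` below `δ'`: for all `β ≥ B` there is a Wilson point `g ∈ (0, g₀]`
with `betaOf g = β` (IVT from `tendsto_betaOf`, `continuousOn_betaOf`, `strictAntiOn_betaOf`) whose
orbit enters `tube S h γ γ' ε` at the FIRST step `j` at which its coupling reaches `γ` (coupling `< γ`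
before), with in-chart history. Engine: absorption of the fibre
(`norm_Ψ_le`), drift `(b/2)g³ ≤ φ g y − g ≤ (3b/2)g³` in the `δ'`-bichart, the step count
`(g⁻² − γ⁻²)/(3b) → ∞`, and the ATTRACTION clause (`rt-arc-collapse`'s `WilsonOrbitsCollapse`, proved as
`Triage1Checks …wilsonOrbitsCollapse_holds`, plus the crossing step: increments `≤ 2bγ³`). -/
def TubeVisited : Prop :=
  ∀ (G : Type) [Group G] [TopologicalSpace G] [IsTopologicalGroup G] [CompactSpace G]
    [MeasurableSpace G] [BorelSpace G] (r : LatticeRep G) (M' : ℕ) (S : BalabanBanachStep G r M')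
    (δ' K θ₁ C' : ℝ) (h : ℝ → S.E), IsCurveData S δ' K θ₁ C' h →
    ∀ γ γ' ε : ℝ, 0 < γ → γ + 2 * S.b * γ ^ 3 ≤ γ' → γ' ≤ δ' → 0 < ε →
      ∃ B : ℝ, ∀ β : ℝ, B ≤ β → ∃ g ∈ Set.Ioc 0 S.g₀, S.betaOf g = β ∧
        ∃ j : ℕ, (∀ i ≤ j, S.F^[i] (g, S.yW g) ∈ chart S) ∧
          (∀ i < j, (S.F^[i] (g, S.yW g)).1 < γ) ∧ S.F^[j] (g, S.yW g) ∈ tube S h γ γ' ε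

/-- **Stub 3 statement — gap scaling (the card's lever; covariance bookkeeping).** If the effective
theories cluster at rate `m` uniformly on `U` and the Wilson orbits of `g k` (in-chart history) sit in
`U` after `j k` steps, eventually in `k`, then the fine Wilson theories at `betaOf (g k)` block-cluster
at rate `m` per `M'^(j k)` sites with unit normalisations (`expect_iterate` + `expect_wilson` for ODD
`M'`: `2·((M'^j(2T+1) − 1)/2) + 1 = M'^j(2T+1)`; the constants absorb `1/(c₀ c₀')`). -/
def GapScaling : Prop :=
  ∀ (G : Type) [Group G] [TopologicalSpace G] [IsTopologicalGroup G] [CompactSpace G]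
    [MeasurableSpace G] [BorelSpace G] (r : LatticeRep G) (M' : ℕ) (S : BalabanBanachStep G r M')
    (U : Set (ℝ × S.E)) (m : ℝ), Odd M' →
    (∀ σ : YMSpecies G, ∃ c₀ : ℝ, 0 < c₀ ∧ ∀ g ∈ Set.Ioc 0 S.g₀, c₀ ≤ |S.c g σ|) →
    ClustersOn S U m →
    ∀ (g : ℕ → ℝ) (j : ℕ → ℕ),
      (∀ᶠ k in atTop, g k ∈ Set.Ioc 0 S.g₀ ∧
        (∀ i ≤ j k, S.F^[i] (g k, S.yW (g k)) ∈ chart S) ∧ S.F^[j k] (g k, S.yW (g k)) ∈ U) →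
      BlockClustering r (fun k => S.betaOf (g k)) M' j m

/-- **Stub 4 statement — scale identification (where the TUNING is consumed).** Along an `M`-adic
scheme tuned by `a_k⁻⁸⟨P ; τ_{1/a_k} P⟩ → θ > 0`, with Wilson points `betaOf (g k) = β_k` FIRST reaching
coupling `γ` (inside the tube) at steps `j k`, the tube scale is commensurate with the scheme's unit:
`M'^(j k) ≤ Λ · M^(n k)` eventually. Reason: otherwise, along a subsequence, the orbit point at the
scheme's own scale `M'^i ≈ M^(n k)` is still `j k − i → ∞` monotone drift steps (`≥ (b/2)g³` each, all
below `γ ≤ δ'`) short of `γ`, so its coupling tends to `0` and (attraction + `‖h g‖ ≤ C'g²`) so does its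
fibre coordinate; there `UVSmall S` makes the tuned correlator `< θ/2` on the scheme's own torus
(`L_k ≥ N M'^i` as `a_k L_k → ∞`) — the UV branch `a_k⁻¹ ≪ ξ_k` is excluded by asymptotic freedom; the
IR branch is harmless. -/
def ScaleIdentification : Prop :=
  ∀ (G : Type) [Group G] [TopologicalSpace G] [IsTopologicalGroup G] [CompactSpace G]
    [MeasurableSpace G] [BorelSpace G] (r : LatticeRep G) (M' : ℕ) (S : BalabanBanachStep G r M')
    (δ' K θ₁ C' : ℝ) (h : ℝ → S.E), IsCurveData S δ' K θ₁ C' h →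
    ∀ γ γ' ε : ℝ, 0 < γ → γ ≤ δ' → UVSmall S →
    ∀ (M : ℕ) (θ : ℝ) (sch : SpeciesScheme (YMSpecies G)) (n : ℕ → ℕ) (g : ℕ → ℝ) (j : ℕ → ℕ),
      0 < θ → (∀ k, sch.a k = ((M : ℝ) ^ n k)⁻¹) → Tendsto sch.β atTop atTop →
      Tendsto (fun k => ((M : ℝ) ^ n k) ^ 8 *
        latticeConnectedCorr r.ρ (sch.β k) (sch.side k) r.curvature.F r.curvature.F (M ^ n k))
        atTop (𝓝 θ) →
      (∀ᶠ k in atTop, g k ∈ Set.Ioc 0 S.g₀ ∧ S.betaOf (g k) = sch.β k ∧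
        (∀ i ≤ j k, S.F^[i] (g k, S.yW (g k)) ∈ chart S) ∧
        (∀ i < j k, (S.F^[i] (g k, S.yW (g k))).1 < γ) ∧
        S.F^[j k] (g k, S.yW (g k)) ∈ tube S h γ γ' ε) →
      ∃ Λ : ℝ, 0 < Λ ∧ ∀ᶠ k in atTop, (M' : ℝ) ^ j k ≤ Λ * (M : ℝ) ^ n k

/-- **Stub 5 statement — fine-scale transfer (card stubs (a) `FluctuationDecay` + (b)
`UniformTorusClustering`; triage C1).** Block clustering at rate `m` per `M'^(j k)` sites (all species,
all time-compact block test functions, special tori `M'^(j k)(2T+1)`) implies fine-local clustering of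
EVERY pair of gauge-invariant local observables at some rate `Δ₁` per `M'^(j k)` sites on ALL tori
`2S+1` with `S ≥ S₁ M'^(j k)`, `n ≤ S`, with `k`-uniform per-pair constants. Content: no low-lying
lattice-scale (staggered) modes invisible to block averages, and volume regularity between the
`M'`-adic torus sizes (RP transfer matrix + complete monotonicity un-average in time; spatial
un-averaging and odd/prime tori are the work). -/
def FineScaleTransfer : Prop :=
  ∀ (G : Type) [Group G] [TopologicalSpace G] [IsTopologicalGroup G] [CompactSpace G]
    [MeasurableSpace G] [BorelSpace G] (r : LatticeRep G) (β : ℕ → ℝ) (M' : ℕ) (j : ℕ → ℕ) (m : ℝ),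
    0 < m → BlockClustering r β M' j m →
      ∃ Δ₁ : ℝ, 0 < Δ₁ ∧ ∃ S₁ : ℕ, FineClustering r β (fun k => M' ^ j k) Δ₁ S₁

/-- **Stub 6 statement — spectral transfer of the lattice half to every continuum limit** (Disproof
PROVER NOTE): `HasLatticeMassGap r sch Δ` gives, for every `sch'` with the same `(a, β, L)` and every
`T` with `IsYangMillsFor r sch' T`, `T.HasMassGap Δ` at the SAME rate — via Lüscher/OS positivity of
the Wilson transfer matrix: truncated diagonal correlators of positive-time vectors are Laplace
transforms of positive measures supported in `[Δ, ∞)` whose total masses converge by `IsYangMillsFor`;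
weak limits keep the support; polarisation and density of off-diagonal product tensors among
time-ordered ones do the rest (thermal-trace corrections on the torus `2L_k+1` vanish as
`a_k L_k → ∞`). No observable-uniform constant is claimed. -/
def SpectralTransfer : Prop :=
  ∀ (G : Type) [Group G] [TopologicalSpace G] [IsTopologicalGroup G] [CompactSpace G]
    [MeasurableSpace G] [BorelSpace G] (r : LatticeRep G) (sch : SpeciesScheme (YMSpecies G)) (Δ : ℝ),
    0 < Δ → HasLatticeMassGap r sch Δ →
      ∀ sch' : SpeciesScheme (YMSpecies G), sch'.a = sch.a → sch'.β = sch.β → sch'.L = sch.L →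
        ∀ T : OSData (YMSpecies G) 4, IsYangMillsFor r sch' T → T.HasMassGap Δ


/-! ## §3 Glue (the only theorem of this file) -/

/-- **Chart membership, unfolded** — the registered glue lemma shared by the dynamics stubs
(`stub_tubeVisited`, `stub_scaleIdentification`, `stub_gapScaling`): a point lies in the chart
`[0, δ] × B̄_R` iff its coupling is in `[0, δ]` and its fibre coordinate has norm `≤ R`. -/
theorem mem_chart_iff : ∀ {G : Type} [Group G] [TopologicalSpace G] [IsTopologicalGroup G] [CompactSpace G] [MeasurableSpace G] [BorelSpace G] {r : LatticeRep G} {M : ℕ} (S : BalabanBanachStep G r M) (p : ℝ × S.E), p ∈ chart S ↔ p.1 ∈ Set.Icc 0 S.δ ∧ ‖p.2‖ ≤ S.R := by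
  intro G _ _ _ _ _ _ r M S p
  simp only [chart, Set.mem_prod, Metric.mem_closedBall, dist_zero_right]

end Summit.QuantumFields.YangMills.Cruxes.LatticeGapOnTrajectory.TrajectoryGapScaling

end
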